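import Literature.AlgebraicGeometry.Resolution.DiffOpPrincipalParts
import Mathlib.RingTheory.Noetherian.Basic
import HarnessLib

/-!
# The principal parts `P^n_{A/R}` are finite over `A` for `A` essentially of finite type; `Diff^{≤ n}_{A/R}` is then
# finitely generated for `A` Noetherian (EGA IV₄ Prop. 16.3.9, (16.8.3.1), Prop. 16.8.8)

Topic: `Literature/AlgebraicGeometry/Resolution`. Companion of `DifferentialOperators.lean` (`diffOp R A n =
Diff^{≤ n}_{A/R}`, Grothendieck's operators of order `≤ n` by the commutator criterion EGA IV₄ 16.8.8 (b)),
`DiffOpPrincipalParts.lean` (`principalPartsRing R A n = P^n_{A/R} = (A ⊗_R A)/I^{n+1}`, Déf. 16.8.1, and the PROVED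
comparison `EGA4_Prop16_8_8_holds`) and `DiffOpFiniteType.lean` (`diffOp_fg`: finiteness of `Diff^{≤ n}_{A/R}` for `A`
Noetherian OF FINITE TYPE over `R`, by an elementary uniqueness argument avoiding principal parts). Proved here
(sorry-free, ordinary commutative algebra over Mathlib):

* `top_le_span_monomials_sup_pow` — if the diagonal ideal `I = ker(A ⊗_R A → A)` is generated by a finite set `T`,
  then for every `n` the left `A`-module `A ⊗_R A` is `span_A {monomials of degree ≤ n in T} + I^{n+1}`
  (induction on `n`: `x = μ(x)•1 + (x − μ(x) ⊗ 1)`, then `I = Σ_t (A ⊗ A)·t`, `t ∈ T`);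
* **`principalParts_finite`** — `Module.Finite A (principalPartsRing R A n)` for `A` ESSENTIALLY of finite type over
  `R` (Mathlib `Algebra.EssFiniteType`: of finite type, or a localization of such — e.g. the local rings `𝒪_{Z,ξ}` of a
  scheme of finite type over a field); the input is Mathlib's `KaehlerDifferential.ideal_fg` (`I` is a finitely
  generated ideal). This is EGA IV₄ Prop. (16.3.9) («Supposons que f : X → S soit un morphisme localement de type
  fini. Alors les 𝒫ⁿ_{X/S} et les 𝒢r_n(𝒫_{X/S}) sont des 𝒪_X-Modules quasi-cohérents de type fini», printed p.16) in
  the affine description (16.3.7) p.15 (`P^n_{B/A} = (B ⊗_A B)/𝔍^{n+1}`), extended to the essentially-finite-type case;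
* `range_diffOpOfPrincipalParts` — `Diff^{≤ n}_{A/R}` is the image of `Hom_A(P^n_{A/R}, A)` under `u ↦ u ∘ d^n`
  (EGA IV₄ (16.8.3.1) with Prop. 16.8.8, from the proved `EGA4_16_8.*` comparison lemmas);
* **`diffOp_fg_of_essFiniteType`** — for `A` Noetherian and essentially of finite type over `R`, every
  `Diff^{≤ n}_{A/R}` is a finitely generated `A`-module (extends `diffOp_fg` of `DiffOpFiniteType.lean` from finite
  type to essentially finite type, e.g. to localizations and local rings of finite-type algebras).

Why now: the res-hironaka adjudication (GAP-LEDGER R67, reading «orderwise») isolated the proposition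
`∀ m, (diffOp K A m).FG` as a load-bearing input; `DiffOpFiniteType.lean` settles it for finite-type `A`, this file
for the stalks / localizations as well, and records the finiteness of `P^n` itself. Nothing here refers to the
manuscript under adjudication.

## References
* [EGAIV4] A. Grothendieck, J. Dieudonné, ÉGA IV₄, Publ. Math. IHÉS 32 (1967): (16.3.7) p.15, Prop. (16.3.8) and
  Prop. (16.3.9) p.16 (finiteness of `𝒫ⁿ`), Déf. (16.8.1) p.39, (16.8.3.1) p.41, Prop. (16.8.8) p.42 — read on the held
  copy `paper:doi-10-1007-bf02732123` (page file `p00NN.txt` = printed page NN+1: (16.3.7) = p0014.txt l.31–52,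
  (16.3.8)/(16.3.9) = p0015.txt l.7–14).
-/

noncomputable section

namespace Literature.AlgebraicGeometry.Resolution

open scoped TensorProduct Pointwise

universe u v

section Monomials

variable {S : Type v} [CommMonoid S]

/-- Powers of a finite set (pointwise) are finite (private helper). [folklore] -/
private theorem finite_pow {s : Set S} (hs : s.Finite) : ∀ k : ℕ, (s ^ k).Finite
  | 0 => by rw [pow_zero]; exact Set.finite_one
  | k + 1 => by rw [pow_succ]; exact (finite_pow hs k).mul hs

/-- The monomials of degree `≤ n` in a finite set `T` — `⋃_{k ≤ n} T^k` (pointwise powers) — form a finite set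
(private helper). [folklore] -/
private theorem monomialsLE_finite (T : Finset S) (n : ℕ) :
    (⋃ k ∈ Finset.range (n + 1), ((T : Set S) ^ k)).Finite :=
  Set.Finite.biUnion (Finset.finite_toSet _) fun k _ => finite_pow (Finset.finite_toSet T) k

/-- `1` is a monomial of degree `≤ n` (the empty product; private helper). [folklore] -/
private theorem one_mem_monomialsLE (T : Finset S) (n : ℕ) :
    (1 : S) ∈ ⋃ k ∈ Finset.range (n + 1), ((T : Set S) ^ k) :=
  Set.mem_iUnion₂.mpr ⟨0, Finset.mem_range.mpr (Nat.succ_pos n), by rw [pow_zero]; exact Set.one_mem_one⟩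

/-- A monomial of degree `≤ n` times an element of `T` is a monomial of degree `≤ n + 1` (private helper).
[folklore] -/
private theorem mul_mem_monomialsLE_succ {T : Finset S} {n : ℕ} {m : S}
    (hm : m ∈ ⋃ k ∈ Finset.range (n + 1), ((T : Set S) ^ k)) {t : S} (ht : t ∈ T) :
    m * t ∈ ⋃ k ∈ Finset.range (n + 1 + 1), ((T : Set S) ^ k) := by
  obtain ⟨k, hk, hmk⟩ := Set.mem_iUnion₂.mp hm
  refine Set.mem_iUnion₂.mpr ⟨k + 1, ?_, ?_⟩
  · rw [Finset.mem_range] at hk ⊢; omega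
  · rw [pow_succ]; exact Set.mul_mem_mul hmk (Finset.mem_coe.mpr ht)

end Monomials

section PrincipalPartsFinite

variable {R : Type u} [CommRing R] {A : Type v} [CommRing A] [Algebra R A]

/-- `x − μ(x) ⊗ 1 ∈ I` for the multiplication `μ : A ⊗_R A → A` and the diagonal ideal `I = ker μ`. [folklore] -/
private theorem sub_lmul_tmul_one_mem_ideal (x : A ⊗[R] A) :
    x - (Algebra.TensorProduct.lmul' R (S := A) x) ⊗ₜ[R] (1 : A) ∈ KaehlerDifferential.ideal R A := by
  rw [KaehlerDifferential.ideal, RingHom.mem_ker, map_sub, Algebra.TensorProduct.lmul'_apply_tmul, mul_one,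
    sub_self]

/-- `A ⊗_R A = A•1 + I` (left structure): the degree-`0` case. [folklore] -/
private theorem mem_span_one_sup_ideal (x : A ⊗[R] A) :
    x ∈ (A ∙ (1 : A ⊗[R] A)) ⊔ (KaehlerDifferential.ideal R A).restrictScalars A := by
  have hx : x = (Algebra.TensorProduct.lmul' R (S := A) x) • (1 : A ⊗[R] A) +
      (x - (Algebra.TensorProduct.lmul' R (S := A) x) ⊗ₜ[R] (1 : A)) := by
    rw [Algebra.TensorProduct.one_def, TensorProduct.smul_tmul', smul_eq_mul, mul_one, add_sub_cancel]
  rw [hx]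
  exact Submodule.add_mem_sup (Submodule.smul_mem _ _ (Submodule.mem_span_singleton_self _))
    (sub_lmul_tmul_one_mem_ideal x)

/-- **`A ⊗_R A = span_A {monomials of degree ≤ n in T} + I^{n+1}`** whenever the finite set `T` generates the
diagonal ideal `I` (as an ideal). Induction on `n`: `I = Σ_t (A ⊗ A)·t` and `(A ⊗ A)·t ⊆ (N_n + I^{n+1})·t ⊆
N_{n+1} + I^{n+2}`. [cite: EGAIV4, (16.3.7) p.15 and Prop. (16.3.9) p.16 (proof made explicit at ring level)] -/
theorem top_le_span_monomials_sup_pow (T : Finset (A ⊗[R] A))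
    (hT : Ideal.span (T : Set (A ⊗[R] A)) = KaehlerDifferential.ideal R A) :
    ∀ n : ℕ, (⊤ : Submodule A (A ⊗[R] A)) ≤
      Submodule.span A (⋃ k ∈ Finset.range (n + 1), ((T : Set (A ⊗[R] A)) ^ k)) ⊔
        (KaehlerDifferential.ideal R A ^ (n + 1)).restrictScalars A
  | 0 => by
    intro x _
    rw [zero_add, pow_one]
    have h1 : (A ∙ (1 : A ⊗[R] A)) ≤ Submodule.span A (⋃ k ∈ Finset.range (0 + 1), ((T : Set (A ⊗[R] A)) ^ k)) :=
      Submodule.span_mono (Set.singleton_subset_iff.mpr (one_mem_monomialsLE T 0))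
    exact sup_le_sup_right h1 _ (mem_span_one_sup_ideal x)
  | n + 1 => by
    intro x _
    -- abbreviations
    set N : Submodule A (A ⊗[R] A) :=
      Submodule.span A (⋃ k ∈ Finset.range (n + 1 + 1), ((T : Set (A ⊗[R] A)) ^ k)) with hN
    set K : Submodule A (A ⊗[R] A) := (KaehlerDifferential.ideal R A ^ (n + 1 + 1)).restrictScalars A
      with hK
    have IH := top_le_span_monomials_sup_pow T hT n
    -- every element of `I = span T` lies in `N ⊔ K`, uniformly under multiplication by `A ⊗ A`
    have hI : ∀ y ∈ Ideal.span (T : Set (A ⊗[R] A)), ∀ s : A ⊗[R] A, s * y ∈ N ⊔ K := by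
      intro y hy
      refine Submodule.span_induction ?_ ?_ ?_ ?_ hy
      · intro t ht s
        obtain ⟨ν, hν, z, hz, rfl⟩ := Submodule.mem_sup.mp (IH (Submodule.mem_top : s ∈ ⊤))
        rw [add_mul]
        refine Submodule.add_mem_sup ?_ ?_
        · -- `ν * t ∈ N_{n+1}`
          refine Submodule.span_induction (p := fun ν _ => ν * t ∈ N) ?_ ?_ ?_ ?_ hν
          · exact fun m hm => Submodule.subset_span (mul_mem_monomialsLE_succ hm ht)
          · rw [zero_mul]; exact zero_mem _
          · intro a b _ _ ha hb; rw [add_mul]; exact add_mem ha hb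
          · intro a m _ hm; rw [smul_mul_assoc]; exact Submodule.smul_mem _ _ hm
        · -- `z * t ∈ I^{n+2}`
          change z * t ∈ KaehlerDifferential.ideal R A ^ (n + 1 + 1)
          rw [pow_succ]
          exact Ideal.mul_mem_mul hz (hT ▸ Ideal.subset_span ht)
      · intro s; rw [mul_zero]; exact zero_mem _
      · intro y₁ y₂ _ _ h₁ h₂ s; rw [mul_add]; exact add_mem (h₁ s) (h₂ s)
      · intro s' y _ h s; rw [smul_eq_mul, ← mul_assoc]; exact h (s * s')
    -- decompose `x = μ(x)•1 + (x − μ(x) ⊗ 1)`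
    obtain ⟨x₀, hx₀, y, hy, rfl⟩ := Submodule.mem_sup.mp (mem_span_one_sup_ideal (R := R) x)
    refine add_mem ?_ ?_
    · refine Submodule.mem_sup_left (Submodule.span_mono ?_ hx₀)
      exact Set.singleton_subset_iff.mpr (one_mem_monomialsLE T (n + 1))
    · have := hI y (by rw [hT]; exact hy) 1
      rwa [one_mul] at this

variable (R A)

/-- **`P^n_{A/R}` is a finitely generated `A`-module** (left structure) when `A` is essentially of finite type over
`R` (then the diagonal ideal is finitely generated — Mathlib `KaehlerDifferential.ideal_fg` — and `P^n` is spanned by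
the classes of the monomials of degree `≤ n` in its generators): EGA IV₄ Prop. (16.3.9) «si f est localement de type
fini … les 𝒫ⁿ_{X/S} … sont des 𝒪_X-Modules quasi-cohérents de type fini», affine case (16.3.7).
[cite: EGAIV4, Prop. (16.3.9) p.16] -/
theorem principalParts_finite [Algebra.EssFiniteType R A] (n : ℕ) :
    Module.Finite A (principalPartsRing R A n) := by
  classical
  obtain ⟨T, hT⟩ := KaehlerDifferential.ideal_fg R A
  let φ : A ⊗[R] A →ₐ[A] principalPartsRing R A n :=
    Ideal.Quotient.mkₐ A (KaehlerDifferential.ideal R A ^ (n + 1))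
  refine ⟨Submodule.fg_def.mpr ⟨φ '' ⋃ k ∈ Finset.range (n + 1), ((T : Set (A ⊗[R] A)) ^ k),
    (monomialsLE_finite T n).image _, ?_⟩⟩
  refine eq_top_iff.mpr fun q _ => ?_
  obtain ⟨x, rfl⟩ := Ideal.Quotient.mkₐ_surjective A _ q
  obtain ⟨ν, hν, z, hz, rfl⟩ :=
    Submodule.mem_sup.mp (top_le_span_monomials_sup_pow T hT n (Submodule.mem_top : x ∈ ⊤))
  have hz0 : φ z = 0 := by
    change Ideal.Quotient.mk _ z = 0
    exact Ideal.Quotient.eq_zero_iff_mem.mpr hz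
  rw [map_add, hz0, add_zero]
  -- `φ ν ∈ span (φ '' monomials) = map φ (span A monomials)`
  have hspan : Submodule.span A (φ '' ⋃ k ∈ Finset.range (n + 1), ((T : Set (A ⊗[R] A)) ^ k)) =
      Submodule.map φ.toLinearMap
        (Submodule.span A (⋃ k ∈ Finset.range (n + 1), ((T : Set (A ⊗[R] A)) ^ k))) :=
    (Submodule.map_span φ.toLinearMap _).symm
  rw [hspan]
  exact Submodule.mem_map_of_mem hν

end PrincipalPartsFinite

section DiffOpFinite

variable {R : Type u} [CommRing R] {A : Type v} [CommRing A] [Algebra R A]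

/-- **`Diff^{≤ n}_{A/R}` is the image of `Hom_A(P^n_{A/R}, A)` under `u ↦ u ∘ d^n`** (EGA IV₄ (16.8.3.1) with
Prop. 16.8.8: `diffOp = range diffOpOfPrincipalParts`). [cite: EGAIV4, (16.8.3.1) and Prop. 16.8.8] -/
theorem range_diffOpOfPrincipalParts (n : ℕ) :
    LinearMap.range (diffOpOfPrincipalParts R A n) = diffOp R A n := by
  ext D
  rw [LinearMap.mem_range, mem_diffOp_iff, EGA4_16_8.isDiffOpLE_iff_kills, ← EGA4_16_8.isDiffOpPP_iff_kills]
  unfold IsDiffOpPP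
  constructor
  · rintro ⟨u, hu⟩; exact ⟨u, hu.symm⟩
  · rintro ⟨u, hu⟩; exact ⟨u, hu.symm⟩

variable (R A)

/-- **`Diff^{≤ n}_{A/R}` is a finitely generated `A`-module** for `A` Noetherian and ESSENTIALLY of finite type over
`R` (e.g. a localization or a local ring of a finite-type algebra over a field): `Diff^{≤ n} = image of Hom_A(P^n, A)`,
`P^n` finite over `A`, and `Hom_A` of a finite module into a Noetherian ring is finite. The finite-type case is
`diffOp_fg` / `diffOp_fg_of_isNoetherianRing` of `DiffOpFiniteType.lean` (different proof). [cite: EGAIV4, (16.8.3.1) p.41, Prop. (16.8.8) p.42 and Prop. (16.3.9) p.16] -/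
theorem diffOp_fg_of_essFiniteType [Algebra.EssFiniteType R A] [IsNoetherianRing A] (n : ℕ) :
    (diffOp R A n).FG := by
  haveI : Module.Finite A (principalPartsRing R A n) := principalParts_finite R A n
  haveI : IsNoetherian A (principalPartsRing R A n →ₗ[A] A) := inferInstance
  rw [← range_diffOpOfPrincipalParts, LinearMap.range_eq_map]
  exact Module.Finite.fg_top.map _

end DiffOpFinite

end Literature.AlgebraicGeometry.Resolution
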